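import Summits.AtomisticToContinuum.BoseEinsteinCondensation.Theses.BECInfDivCoherence
import Summits.AtomisticToContinuum.BoseEinsteinCondensation.Theorems.BECInfDivCoherenceGridAverageCondensateFourier
import Literature.MathematicalPhysics.QuantumManyBody.InsertionStateIdentities
import Literature.MathematicalPhysics.QuantumManyBody.PeriodicCoherenceFunction
import HarnessLib

/-!
# Route `BECInfDivCoherence`, support item `GridAverageCondensate` (stmt-AtomisticToContinuum-9116)

**Aliasing on the torus.** For a periodic `C¹` trial state `Ψ` of `N` bosons on the torus of side
`L > 0`, a grid of `m ≥ 1` points per side, `T ≥ 0` with total kinetic energy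
`∫_{cell^N} |∇Ψ|² ≤ T`, and any particle `i`, the grid average of the translation coherence
`G(r) = Re ∫_{cell^N} conj Ψ(…, xᵢ + r, …) Ψ(X) dX` over the `m³` nodes `(L/m) j` satisfies
`condensateOccupation N L Ψ ≥ N · m⁻³ Σⱼ G((L/m)j) − T (L/m)²/(4π²)` (in `ℝ≥0∞`, with `ofReal` on
the left).

Proof (Fourier series in the tagged particle, [LSSY2005, App. A (A.11)–(A.13)] mechanics; the
aliasing/Poincaré step is folklore):

1. Bose symmetry moves particle `i` to slot `0` (`setIntegral_cellN_comp_perm`), and Fubini with the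
   tagged slot innermost (`setIntegral_cellN_succ_right_of_continuous`) reduces to the slices
   `φ_Y = Ψ(·, Y)`, `Y ∈ cell^{N-1}`.
2. For a continuous `Lℤ³`-periodic `φ`: polarised Parseval on the cell and the translate rule
   `ĉ_k(φ(· + r)) = e_k(r) ĉ_k(φ)` give `∫_cell conj φ(x + r) φ(x) dx = L³ Σ_k conj e_k(r) |ĉ_k|²`;
   the character sum `Σ_{j ∈ (ℤ/m)³} e_k((L/m) j) = m³ · [k ∈ mℤ³]` (`sum_cellWave_grid`) then gives
   `Σⱼ ∫_cell conj φ(x + (L/m)j) φ(x) dx = L³ m³ Σ_{k ∈ mℤ³} |ĉ_k|²` (`sum_integral_translate_eq`).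
3. Aliasing bound: `Σ_{k ∈ mℤ³} |ĉ_k|² ≤ |ĉ_0|² + (L²/(4π²m²)) Σ_k |2πk/L|² |ĉ_k|²` since
   `|k| ≥ m` on `mℤ³ ∖ 0` (`tsum_coarse_le`).
4. Integrating over `Y`: `N L³ ∫ |ĉ_0(Y)|² = n₀` (`momentumOccupation_succ`, `momentumOccupation_zero`)
   and `N L³ ∫ Σ_k |2πk/L|² |ĉ_k(Y)|² = Σ_k |2πk/L|² n_k = ∫ |∇Ψ|² ≤ T`
   (`tsum_normSq_waveVector_mul_momentumOccupation`, which is where Bose symmetry turns the kinetic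
   energy of ONE particle into `T/N`).

References: E. H. Lieb, R. Seiringer, J. P. Solovej, J. Yngvason, *The Mathematics of the Bose Gas
and its Condensation* (2005), App. A; S. Fournais, *Length scales for BEC in the dilute Bose gas*
(2020), §3 (Fourier bookkeeping on the periodic cell).
-/

noncomputable section

open MeasureTheory Filter Complex
open scoped ENNReal NNReal ComplexConjugate

namespace Summit.AtomisticToContinuum.BoseEinsteinCondensation.Theorems.BECInfDivCoherenceGridAverage

open Literature.MathematicalPhysics.QuantumManyBody.BoseGas

variable {L : ℝ}

/-! ### The many-body bookkeeping -/

section ManyBody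

variable {n : ℕ}

/-- Bose symmetry moves the translated particle to slot `0`:
`conj Ψ(update X i (xᵢ + r)) Ψ(X) = F(X ∘ (0 i))` with `F(Z) = conj Ψ(Z + r e₀) Ψ(Z)`. [folklore] -/
theorem conj_update_mul_eq_comp_swap (Ψ : PeriodicTrialState (n + 1) L) (i : Fin (n + 1))
    (r : Space) (X : Config (n + 1)) :
    conj (Ψ.ψ (Function.update X i (X i + r))) * Ψ.ψ X =
      (fun Z : Config (n + 1) => conj (Ψ.ψ (Z + Pi.single 0 r)) * Ψ.ψ Z) (X ∘ Equiv.swap 0 i) := by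
  have h1 : Function.update X i (X i + r) = X + Pi.single i r := by
    rw [update_add_eq, Function.update_eq_self]
  have h2 : (X ∘ Equiv.swap 0 i) + Pi.single 0 r = (X + Pi.single i r) ∘ Equiv.swap 0 i := by
    funext t
    simp only [Pi.add_apply, Function.comp_apply, Pi.single_apply, Equiv.swap_apply_eq_iff,
      Equiv.swap_apply_right]
  simp only [h1]
  rw [h2, Ψ.symm, Ψ.symm]

/-- **The grid sum through slices**: with `φ_Y = Ψ(·, Y)` and the coarse Parseval density
`t(Y) = Σ_{k ∈ mℤ³} m³ |ĉ_k(φ_Y)|²`, the function `Y ↦ L³ t(Y)` is integrable on `cell^n` and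
`Σⱼ ∫_{cell^{n+1}} conj Ψ(update X i (xᵢ + (L/m)j)) Ψ(X) dX = ∫_{cell^n} L³ t(Y) dY` (as a complex
number). The single-shift slice identity used on the way —
`∫_{cell^{n+1}} conj Ψ(update X i (xᵢ + r)) Ψ(X) dX = ∫_{cell^n} ∫_cell conj Ψ(x + r, Y) Ψ(x, Y) dx dY`,
Bose symmetry + Fubini with the tagged slot innermost — is the tree's
`Theorems.setIntegral_conj_translate_mul_eq_slice` (BallCriterion helper of route
BECSubharmonicContinuation); it is re-derived inline here so that this route's import cone stays inside
`Literature` (no cross-route import edge). [folklore] -/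
theorem sum_setIntegral_conj_update_mul (hL : 0 < L) {m : ℕ} (hm : 0 < m)
    (Ψ : PeriodicTrialState (n + 1) L) (i : Fin (n + 1)) :
    Integrable (fun Y : Config n => (L ^ 3 * ∑' k : Fin 3 → ℤ,
        (if (∀ a, (m : ℤ) ∣ k a) then (m : ℝ) ^ 3 *
          ‖cellFourierCoeff L (fun x => Ψ.ψ (Matrix.vecCons x Y)) k‖ ^ 2 else 0 : ℝ)))
      (volume.restrict (cellN n L)) ∧
    (∑ j : Fin 3 → Fin m, ∫ X in cellN (n + 1) L,
        conj (Ψ.ψ (Function.update X i (X i + latticeVec (L / m) (fun a => ((j a : ℕ) : ℤ))))) *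
          Ψ.ψ X) =
      ∫ Y in cellN n L, (((L ^ 3 * ∑' k : Fin 3 → ℤ,
        (if (∀ a, (m : ℤ) ∣ k a) then (m : ℝ) ^ 3 *
          ‖cellFourierCoeff L (fun x => Ψ.ψ (Matrix.vecCons x Y)) k‖ ^ 2 else 0 : ℝ)) : ℝ) : ℂ) := by
  have hΨc : Continuous Ψ.ψ := Ψ.contDiff.continuous
  -- single-shift slice identity: Bose symmetry to slot `0`, then Fubini (tagged slot innermost)
  have hslice : ∀ r : Space,
      ∫ X in cellN (n + 1) L, conj (Ψ.ψ (Function.update X i (X i + r))) * Ψ.ψ X =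
        ∫ Y in cellN n L, ∫ x in cell L,
          conj (Ψ.ψ (Matrix.vecCons (x + r) Y)) * Ψ.ψ (Matrix.vecCons x Y) := by
    intro r
    set F : Config (n + 1) → ℂ := fun Z => conj (Ψ.ψ (Z + Pi.single 0 r)) * Ψ.ψ Z with hF
    have hFc : Continuous F :=
      (Complex.continuous_conj.comp (hΨc.comp (continuous_id.add continuous_const))).mul hΨc
    have h1 : (fun X : Config (n + 1) => conj (Ψ.ψ (Function.update X i (X i + r))) * Ψ.ψ X) =
        fun X => F (X ∘ Equiv.swap 0 i) := by
      funext X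
      exact conj_update_mul_eq_comp_swap Ψ i r X
    rw [h1, setIntegral_cellN_comp_perm L (Equiv.swap 0 i) F,
      setIntegral_cellN_succ_right_of_continuous hFc]
    refine integral_congr_ae (Eventually.of_forall fun Y => ?_)
    refine integral_congr_ae (Eventually.of_forall fun x => ?_)
    simp only [hF, ← vecCons_add_left]
  simp only [hslice]
  -- each slice integral `Y ↦ ∫_cell …` is integrable on `cell^n`
  have hint : ∀ j : Fin 3 → Fin m, Integrable (fun Y : Config n => ∫ x in cell L,
      conj (Ψ.ψ (Matrix.vecCons (x + latticeVec (L / m) (fun a => ((j a : ℕ) : ℤ))) Y)) *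
        Ψ.ψ (Matrix.vecCons x Y)) (volume.restrict (cellN n L)) := by
    intro j
    set r : Space := latticeVec (L / m) (fun a => ((j a : ℕ) : ℤ)) with hr
    have hFc : Continuous fun Z : Config (n + 1) => conj (Ψ.ψ (Z + Pi.single 0 r)) * Ψ.ψ Z :=
      (Complex.continuous_conj.comp (hΨc.comp (continuous_id.add continuous_const))).mul hΨc
    have h := (integrable_comp_vecCons_prod_restrict (L := L) hFc).integral_prod_right
    refine h.congr (Eventually.of_forall fun Y => ?_)
    refine integral_congr_ae (Eventually.of_forall fun x => ?_)
    simp only [← vecCons_add_left]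
  -- per slice: continuity and periodicity of `φ_Y`, hence the aliasing identity
  have hφ : ∀ Y : Config n, Continuous (fun x => Ψ.ψ (Matrix.vecCons x Y)) ∧
      (∀ (x : Space) (k : Fin 3),
        Ψ.ψ (Matrix.vecCons (x + EuclideanSpace.single k L) Y) = Ψ.ψ (Matrix.vecCons x Y)) :=
    fun Y => ⟨continuous_vecCons_slice hΨc Y, fun x k => Ψ.vecCons_add_axis x Y k⟩
  have hpt : ∀ Y : Config n, (∑ j : Fin 3 → Fin m, ∫ x in cell L,
      conj (Ψ.ψ (Matrix.vecCons (x + latticeVec (L / m) (fun a => ((j a : ℕ) : ℤ))) Y)) *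
        Ψ.ψ (Matrix.vecCons x Y)) = (((L ^ 3 * ∑' k : Fin 3 → ℤ,
        (if (∀ a, (m : ℤ) ∣ k a) then (m : ℝ) ^ 3 *
          ‖cellFourierCoeff L (fun x => Ψ.ψ (Matrix.vecCons x Y)) k‖ ^ 2 else 0 : ℝ)) : ℝ) : ℂ) :=
    fun Y => (sum_integral_translate_eq hL hm (hφ Y).1 (hφ Y).2).2
  have hintsum : Integrable (fun Y : Config n => ∑ j : Fin 3 → Fin m, ∫ x in cell L,
      conj (Ψ.ψ (Matrix.vecCons (x + latticeVec (L / m) (fun a => ((j a : ℕ) : ℤ))) Y)) *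
        Ψ.ψ (Matrix.vecCons x Y)) (volume.restrict (cellN n L)) :=
    integrable_finsetSum _ (fun j _ => hint j)
  refine ⟨?_, ?_⟩
  · have h := Complex.reCLM.integrable_comp (hintsum.congr (Eventually.of_forall hpt))
    refine h.congr (Eventually.of_forall fun Y => ?_)
    simp only [Complex.reCLM_apply, Complex.ofReal_re]
  · rw [← integral_finsetSum _ (fun j _ => hint j)]
    exact integral_congr_ae (Eventually.of_forall hpt)

/-- **Momentum form of the kinetic energy through slices**:
`N L³ ∫_{cell^n} Σ_k |2πk/L|² |ĉ_k(φ_Y)|² dY = Σ_k |2πk/L|² n_k(Ψ)`. [cite: LSSY2005, App. A (A.10), (A.13)] -/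
theorem succ_mul_lintegral_tsum_eq (hL : 0 < L) (Ψ : Config (n + 1) → ℂ) (hΨ : Continuous Ψ) :
    (n + 1 : ℝ≥0∞) * (ENNReal.ofReal L ^ 3 * ∫⁻ Y in cellN n L, ∑' k : Fin 3 → ℤ,
        ENNReal.ofReal (‖waveVector L k‖ ^ 2) *
          (‖cellFourierCoeff L (fun x => Ψ (Matrix.vecCons x Y)) k‖₊ : ℝ≥0∞) ^ 2) =
      ∑' k, ENNReal.ofReal (‖waveVector L k‖ ^ 2) * momentumOccupation (n + 1) L k Ψ := by
  have hg : ∀ k : Momentum, Measurable fun Y : Config n =>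
      (‖cellFourierCoeff L (fun x => Ψ (Matrix.vecCons x Y)) k‖₊ : ℝ≥0∞) ^ 2 := fun k =>
    ((measurable_cellFourierCoeff_vecCons hL k hΨ).nnnorm.coe_nnreal_ennreal).pow_const _
  simp only [momentumOccupation_succ hL]
  rw [lintegral_tsum fun k => ((hg k).const_mul _).aemeasurable, ← ENNReal.tsum_mul_left,
    ← ENNReal.tsum_mul_left]
  refine tsum_congr fun k => ?_
  rw [lintegral_const_mul _ (hg k)]
  ring

/-- **The aliasing bound for an `N = n+1`-body periodic state** (the item with `N * avg` written as
`ofReal`): `ofReal((n+1) · m⁻³ Σⱼ G((L/m)j)) ≤ n₀ + (L²/(4π²m²)) ∫ |∇Ψ|²`. [folklore] -/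
theorem ofReal_grid_average_le (hL : 0 < L) {m : ℕ} (hm : 0 < m)
    (Ψ : PeriodicTrialState (n + 1) L) (i : Fin (n + 1)) :
    ENNReal.ofReal (((n + 1 : ℕ) : ℝ) * (∑ j : Fin 3 → Fin m, (∫ X in cellN (n + 1) L,
        conj (Ψ.ψ (Function.update X i (X i + latticeVec (L / m) (fun k => ((j k : ℕ) : ℤ))))) *
          Ψ.ψ X).re) / (m : ℝ) ^ 3) ≤
      condensateOccupation (n + 1) L Ψ.ψ +
        ENNReal.ofReal (L ^ 2 / (4 * Real.pi ^ 2 * (m : ℝ) ^ 2)) *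
          ∫⁻ X in cellN (n + 1) L, kineticDensity Ψ.ψ X := by
  classical
  have hΨc : Continuous Ψ.ψ := Ψ.contDiff.continuous
  have hL3 : ENNReal.ofReal L ^ 3 ≠ ⊤ := ENNReal.pow_ne_top ENNReal.ofReal_ne_top
  have hm0 : (m : ℝ) ≠ 0 := by exact_mod_cast hm.ne'
  set κ : ℝ≥0∞ := ENNReal.ofReal (L ^ 2 / (4 * Real.pi ^ 2 * (m : ℝ) ^ 2)) with hκ
  -- the coarse Parseval density of the slices
  set t : Config n → ℝ := fun Y => ∑' k : Fin 3 → ℤ,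
    (if (∀ a, (m : ℤ) ∣ k a) then (m : ℝ) ^ 3 *
      ‖cellFourierCoeff L (fun x => Ψ.ψ (Matrix.vecCons x Y)) k‖ ^ 2 else 0 : ℝ) with ht
  set P : Config n → ℝ≥0∞ := fun Y => ∑' k : Fin 3 → ℤ,
    (if (∀ a, (m : ℤ) ∣ k a) then
      ((‖cellFourierCoeff L (fun x => Ψ.ψ (Matrix.vecCons x Y)) k‖₊ : ℝ≥0∞) ^ 2) else 0) with hP
  set S : Config n → ℝ≥0∞ := fun Y => ∑' k : Fin 3 → ℤ, ENNReal.ofReal (‖waveVector L k‖ ^ 2) *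
    (‖cellFourierCoeff L (fun x => Ψ.ψ (Matrix.vecCons x Y)) k‖₊ : ℝ≥0∞) ^ 2 with hS
  -- Step 1: the real number is `∫_Y L³ t(Y)`, with an integrable integrand
  obtain ⟨hI, hsum⟩ := sum_setIntegral_conj_update_mul hL hm Ψ i
  have hA : (∑ j : Fin 3 → Fin m, (∫ X in cellN (n + 1) L,
      conj (Ψ.ψ (Function.update X i (X i + latticeVec (L / m) (fun k => ((j k : ℕ) : ℤ))))) *
        Ψ.ψ X).re) = ∫ Y in cellN n L, L ^ 3 * t Y := by
    rw [← Complex.re_sum, hsum, integral_complex_ofReal, Complex.ofReal_re]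
  have htnn : ∀ Y : Config n, 0 ≤ t Y := fun Y =>
    tsum_nonneg fun k => by
      show 0 ≤ (if (∀ a, (m : ℤ) ∣ k a) then (m : ℝ) ^ 3 *
        ‖cellFourierCoeff L (fun x => Ψ.ψ (Matrix.vecCons x Y)) k‖ ^ 2 else 0 : ℝ)
      split_ifs <;> positivity
  -- Step 2: `ofReal (L³ t Y) = ofReal L ^ 3 * m³ * P Y`
  have hφ : ∀ Y : Config n, Continuous (fun x => Ψ.ψ (Matrix.vecCons x Y)) ∧
      (∀ (x : Space) (k : Fin 3),
        Ψ.ψ (Matrix.vecCons (x + EuclideanSpace.single k L) Y) = Ψ.ψ (Matrix.vecCons x Y)) :=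
    fun Y => ⟨continuous_vecCons_slice hΨc Y, fun x k => Ψ.vecCons_add_axis x Y k⟩
  have htP : ∀ Y : Config n, ENNReal.ofReal (L ^ 3 * t Y) =
      ENNReal.ofReal L ^ 3 * ((m : ℝ≥0∞) ^ 3 * P Y) := by
    intro Y
    have hsble := (sum_integral_translate_eq hL hm (hφ Y).1 (hφ Y).2).1
    have hnn : ∀ k : Fin 3 → ℤ, 0 ≤ (if (∀ a, (m : ℤ) ∣ k a) then (m : ℝ) ^ 3 *
        ‖cellFourierCoeff L (fun x => Ψ.ψ (Matrix.vecCons x Y)) k‖ ^ 2 else 0 : ℝ) := by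
      intro k; split_ifs <;> positivity
    rw [ENNReal.ofReal_mul (by positivity), ENNReal.ofReal_pow hL.le, ht]
    congr 1
    rw [ENNReal.ofReal_tsum_of_nonneg hnn hsble, hP, ← ENNReal.tsum_mul_left]
    refine tsum_congr fun k => ?_
    split_ifs with hD
    · rw [ENNReal.ofReal_mul (by positivity), ← coe_nnnorm_sq_eq_ofReal, ENNReal.ofReal_pow
        (Nat.cast_nonneg m), ENNReal.ofReal_natCast]
    · simp
  -- Step 3: the real number in `ℝ≥0∞`
  have hmeas0 : Measurable fun Y : Config n =>
      (‖cellFourierCoeff L (fun x => Ψ.ψ (Matrix.vecCons x Y)) 0‖₊ : ℝ≥0∞) ^ 2 :=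
    ((measurable_cellFourierCoeff_vecCons hL 0 hΨc).nnnorm.coe_nnreal_ennreal).pow_const _
  have hstep : ENNReal.ofReal (((n + 1 : ℕ) : ℝ) * (∑ j : Fin 3 → Fin m, (∫ X in cellN (n + 1) L,
      conj (Ψ.ψ (Function.update X i (X i + latticeVec (L / m) (fun k => ((j k : ℕ) : ℤ))))) *
        Ψ.ψ X).re) / (m : ℝ) ^ 3) ≤
      (n + 1 : ℝ≥0∞) * (ENNReal.ofReal L ^ 3 * ∫⁻ Y in cellN n L, P Y) := by
    rw [hA]
    have hresc : ((n + 1 : ℕ) : ℝ) * (∫ Y in cellN n L, L ^ 3 * t Y) / (m : ℝ) ^ 3 =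
        ((n + 1 : ℕ) : ℝ) * ∫ Y in cellN n L, ((m : ℝ) ^ 3)⁻¹ * (L ^ 3 * t Y) := by
      rw [integral_const_mul (((m : ℝ) ^ 3)⁻¹)]
      ring
    rw [hresc, ENNReal.ofReal_mul (Nat.cast_nonneg _), ENNReal.ofReal_natCast]
    push_cast
    refine mul_le_mul' le_rfl (le_of_eq ?_)
    rw [ofReal_integral_eq_lintegral_ofReal (hI.const_mul _)
      (Eventually.of_forall fun Y => by
        show 0 ≤ ((m : ℝ) ^ 3)⁻¹ * (L ^ 3 * t Y)
        have := htnn Y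
        positivity)]
    have hpt : ∀ Y : Config n, ENNReal.ofReal (((m : ℝ) ^ 3)⁻¹ * (L ^ 3 * t Y)) =
        ENNReal.ofReal L ^ 3 * P Y := by
      intro Y
      have hm3 : (m : ℝ≥0∞) ^ 3 ≠ 0 := pow_ne_zero _ (by exact_mod_cast hm.ne')
      have hm3' : (m : ℝ≥0∞) ^ 3 ≠ ⊤ := ENNReal.pow_ne_top (ENNReal.natCast_ne_top m)
      rw [ENNReal.ofReal_mul (by positivity), htP Y, ENNReal.ofReal_inv_of_pos (by positivity),
        ENNReal.ofReal_pow (Nat.cast_nonneg m), ENNReal.ofReal_natCast]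
      rw [← mul_assoc, ← mul_assoc, mul_comm ((m : ℝ≥0∞) ^ 3)⁻¹, mul_assoc, mul_assoc,
        ← mul_assoc ((m : ℝ≥0∞) ^ 3)⁻¹, ENNReal.inv_mul_cancel hm3 hm3', one_mul]
    rw [← lintegral_const_mul' _ _ hL3]
    exact lintegral_congr fun Y => hpt Y
  -- Step 4: the pointwise aliasing bound, integrated
  have hPle : ∀ Y : Config n, P Y ≤
      (‖cellFourierCoeff L (fun x => Ψ.ψ (Matrix.vecCons x Y)) 0‖₊ : ℝ≥0∞) ^ 2 + κ * S Y :=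
    fun Y => tsum_coarse_le hL hm _
  have hint : ∫⁻ Y in cellN n L, P Y ≤
      (∫⁻ Y in cellN n L,
        (‖cellFourierCoeff L (fun x => Ψ.ψ (Matrix.vecCons x Y)) 0‖₊ : ℝ≥0∞) ^ 2) +
        κ * ∫⁻ Y in cellN n L, S Y := by
    calc ∫⁻ Y in cellN n L, P Y
        ≤ ∫⁻ Y in cellN n L,
            ((‖cellFourierCoeff L (fun x => Ψ.ψ (Matrix.vecCons x Y)) 0‖₊ : ℝ≥0∞) ^ 2 + κ * S Y) :=
          lintegral_mono fun Y => hPle Y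
      _ = (∫⁻ Y in cellN n L,
            (‖cellFourierCoeff L (fun x => Ψ.ψ (Matrix.vecCons x Y)) 0‖₊ : ℝ≥0∞) ^ 2) +
            κ * ∫⁻ Y in cellN n L, S Y := by
          rw [lintegral_add_left hmeas0, lintegral_const_mul _ (measurable_tsum_sq_grad_vecCons hL hΨc)]
  -- Step 5: identify the two integrals
  have hn0 : (n + 1 : ℝ≥0∞) * (ENNReal.ofReal L ^ 3 * ∫⁻ Y in cellN n L,
      (‖cellFourierCoeff L (fun x => Ψ.ψ (Matrix.vecCons x Y)) 0‖₊ : ℝ≥0∞) ^ 2) =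
        condensateOccupation (n + 1) L Ψ.ψ := by
    rw [← momentumOccupation_zero, momentumOccupation_succ hL]
  have hkin : (n + 1 : ℝ≥0∞) * (ENNReal.ofReal L ^ 3 * ∫⁻ Y in cellN n L, S Y) =
      ∫⁻ X in cellN (n + 1) L, kineticDensity Ψ.ψ X := by
    rw [hS, succ_mul_lintegral_tsum_eq hL Ψ.ψ hΨc,
      tsum_normSq_waveVector_mul_momentumOccupation hL Ψ]
  calc ENNReal.ofReal (((n + 1 : ℕ) : ℝ) * (∑ j : Fin 3 → Fin m, (∫ X in cellN (n + 1) L,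
        conj (Ψ.ψ (Function.update X i (X i + latticeVec (L / m) (fun k => ((j k : ℕ) : ℤ))))) *
          Ψ.ψ X).re) / (m : ℝ) ^ 3)
      ≤ (n + 1 : ℝ≥0∞) * (ENNReal.ofReal L ^ 3 * ∫⁻ Y in cellN n L, P Y) := hstep
    _ ≤ (n + 1 : ℝ≥0∞) * (ENNReal.ofReal L ^ 3 * ((∫⁻ Y in cellN n L,
          (‖cellFourierCoeff L (fun x => Ψ.ψ (Matrix.vecCons x Y)) 0‖₊ : ℝ≥0∞) ^ 2) +
            κ * ∫⁻ Y in cellN n L, S Y)) := by gcongr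
    _ = (n + 1 : ℝ≥0∞) * (ENNReal.ofReal L ^ 3 * ∫⁻ Y in cellN n L,
          (‖cellFourierCoeff L (fun x => Ψ.ψ (Matrix.vecCons x Y)) 0‖₊ : ℝ≥0∞) ^ 2) +
          κ * ((n + 1 : ℝ≥0∞) * (ENNReal.ofReal L ^ 3 * ∫⁻ Y in cellN n L, S Y)) := by ring
    _ = condensateOccupation (n + 1) L Ψ.ψ + κ * ∫⁻ X in cellN (n + 1) L, kineticDensity Ψ.ψ X := by
          rw [hn0, hkin]

end ManyBody

end Summit.AtomisticToContinuum.BoseEinsteinCondensation.Theorems.BECInfDivCoherenceGridAverage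

namespace Summit.AtomisticToContinuum.BoseEinsteinCondensation.Theorems

open Literature.MathematicalPhysics.QuantumManyBody.BoseGas
open Summit.AtomisticToContinuum.BoseEinsteinCondensation.Theorems.BECInfDivCoherenceGridAverage

/-- **`GridAverageCondensate` holds** (settles stmt-AtomisticToContinuum-9116, exact route decl): for
`L > 0`, `m ≥ 1`, `T ≥ 0`, every periodic trial state `Ψ` of `N` bosons with `∫_{cell^N}|∇Ψ|² ≤ T`
and every particle `i`,
`ofReal(N · m⁻³ Σⱼ Re ∫ conj Ψ(update X i (xᵢ + (L/m)j)) Ψ(X) dX − T(L/m)²/(4π²)) ≤ condensateOccupation N L Ψ`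
(aliasing of the coarse grid onto `mℤ³` in momentum space, `|k| ≥ m` off the zero mode, and the
momentum form of the kinetic energy). [folklore] -/
theorem gridAverageCondensate_proof :
    Summit.AtomisticToContinuum.BoseEinsteinCondensation.Theses.BECInfDivCoherence.GridAverageCondensate := by
  unfold Summit.AtomisticToContinuum.BoseEinsteinCondensation.Theses.BECInfDivCoherence.GridAverageCondensate
  intro N m L T hL hm hT Ψ hkin i
  cases N with
  | zero => exact i.elim0
  | succ n =>
    have h := ofReal_grid_average_le hL hm Ψ i
    have hκT : ENNReal.ofReal (L ^ 2 / (4 * Real.pi ^ 2 * (m : ℝ) ^ 2)) *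
        ∫⁻ X in cellN (n + 1) L, kineticDensity Ψ.ψ X ≤
          ENNReal.ofReal (T * (L / m) ^ 2 / (4 * Real.pi ^ 2)) := by
      have hm0 : (m : ℝ) ≠ 0 := by exact_mod_cast hm.ne'
      calc ENNReal.ofReal (L ^ 2 / (4 * Real.pi ^ 2 * (m : ℝ) ^ 2)) *
            ∫⁻ X in cellN (n + 1) L, kineticDensity Ψ.ψ X
          ≤ ENNReal.ofReal (L ^ 2 / (4 * Real.pi ^ 2 * (m : ℝ) ^ 2)) * ENNReal.ofReal T := by
            gcongr
        _ = ENNReal.ofReal (T * (L / m) ^ 2 / (4 * Real.pi ^ 2)) := by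
            rw [← ENNReal.ofReal_mul (by positivity)]
            congr 1
            field_simp
    have hB := h.trans (add_le_add le_rfl hκT)
    rw [ENNReal.ofReal_sub _ (by positivity)]
    exact tsub_le_iff_right.mpr hB

end Summit.AtomisticToContinuum.BoseEinsteinCondensation.Theorems

end
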